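import Summits.BirchSwinnertonDyer.BirchSwinnertonDyer.Theorems.AlignedTransportAtTwoMainConjectureTransportAlignedAtTwoKilfordCopyCrossLevelPlaneOnly
import HarnessLib

/-!
# Crux C1 `MainConjectureTransportAlignedAtTwo` (stmt-BirchSwinnertonDyer-22296), line `birth`, residual (R2) `stub_lamLawKilford`, UNEQUAL conductors:
# SEMISTABLE PAIRS — v27's inline cross-level stub for ANY two curves with squarefree conductors on the stratum, from PLANE(2) at the common level alone
# (width seat att-p3 g18; `--supports 22296`)

THEOREMS ONLY (no `def`, no `sorry`, no named fact). The last packaging step of the cross-level series `…KilfordCopyCrossLevel*`: the two-sided shape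
`N(W₁) = N₀·∏Q₁`, `N(W₂) = N₀·∏Q₂` is produced inside from `Squarefree N(W₁)`, `Squarefree N(W₂)` (`…TwoSided.exists_semistableShape`, `N₀ = gcd`), so the
conclusion's binder is just «both conductors squarefree»; the hypothesis `hPlane` is PLANE(2) at the common level `L = N(W₁)·∏Q₂` for the two old lines
(∀-binder form over the shape data, as in `…Semistable` / `…PlaneOnly`), and the Kraus–Oesterlé parities are theorems (`…LevelRaisingParity`).

* **`sameDepletedKernel_squarefreeConductors_of_twoOldLinesPlane`**.

BSD is not proved by this; C1 is not closed by this; `hPlane` remains the one cross-level input of (R2) for semistable pairs (att-p5 g18's fourth engine confirms it on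
every aligned row; att-p4 g17's `…KilfordKernelLetterCrossLevel` is its consumer).

References: Greenberg–Vatsal 2000 §3 [GreenbergVatsal2000]; Kraus–Oesterlé 1992 Prop. 3 [KrausOesterle1992]; Cremona 1997 §2.10 [CremonaAlgorithms1997].
-/

noncomputable section

-- justification: the `Summit.BirchSwinnertonDyer.BirchSwinnertonDyer.…` path repeats a component (route-file convention)
set_option linter.dupNamespace false
set_option autoImplicit false

open scoped MatrixGroups ModularForm Classical

open CongruenceSubgroup Complex WeierstrassCurve IsDedekindDomain Polynomial
open Literature.NumberTheory.EllipticCurves Literature.NumberTheory.EllipticCurves.ModularForms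
open Literature.NumberTheory.EllipticCurves.Greenberg1999
open Summit.BirchSwinnertonDyer.Rank1Residual.F1Sign2
open Summit.BirchSwinnertonDyer.BirchSwinnertonDyer.Theorems.AlignedTransportAtTwoKilfordCopyCrossLevelTwoSided (exists_semistableShape)
open Summit.BirchSwinnertonDyer.BirchSwinnertonDyer.Theorems.AlignedTransportAtTwoKilfordCopyCrossLevelPlaneOnly (sameDepletedKernel_semistableShape_of_twoOldLinesPlane')

namespace Summit.BirchSwinnertonDyer.BirchSwinnertonDyer.Theorems.AlignedTransportAtTwoKilfordCopyCrossLevelSemistablePairs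

/-- **v27's inline cross-level stub `hCopyNe` for ANY TWO SEMISTABLE CURVES on the stratum (both conductors squarefree), FROM PLANE(2) at the common level
ALONE**: the two-sided shape is read off the conductors (`N₀ = gcd`), the parities are theorems, and `…PlaneOnly.sameDepletedKernel_semistableShape_of_twoOldLinesPlane'`
does the rest. [cite: GreenbergVatsal2000, §3] [cite: KrausOesterle1992, Prop. 3 (p. 262–263)] [cite: CremonaAlgorithms1997, §2.10] -/
theorem sameDepletedKernel_squarefreeConductors_of_twoOldLinesPlane
    (hPlane : ∀ (W₁ : WeierstrassCurve ℚ) [W₁.IsElliptic] [W₁.IsGloballyMinimal]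
      (W₂ : WeierstrassCurve ℚ) [W₂.IsElliptic] [W₂.IsGloballyMinimal],
      IsOrdinaryAt W₁ 2 → IsOrdinaryAt W₂ 2 →
      (∀ x : ℚ, ¬ HasRationalTwoTorsionX W₁ x) → (∀ x : ℚ, ¬ HasRationalTwoTorsionX W₂ x) →
      ¬ IsSquare W₁.Δ → ¬ IsSquare W₂.Δ →
      (¬ ∃ (d : ℚ) (c : WeierstrassCurve.VariableChange ℚ), c • W₁.quadraticTwist d = W₂) →
      OnKilfordStratumAtTwo W₁ →
      ∀ (N₀ : ℕ) (Q₁ Q₂ : Finset ℕ), (∀ q ∈ Q₁, q.Prime) → (∀ q ∈ Q₂, q.Prime) → Disjoint Q₁ Q₂ →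
        (∀ q ∈ Q₁, ¬ q ∣ N₀) → (∀ q ∈ Q₂, ¬ q ∣ N₀) →
        W₁.conductorNorm ℤ = N₀ * ∏ q ∈ Q₁, q → W₂.conductorNorm ℤ = N₀ * ∏ q ∈ Q₂, q →
      ∀ (F : Type) [Field F] [NumberField F], Module.finrank ℚ F = 3 →
      ∀ e₁ e₂ : F, aeval e₁ (twoDivisionUCubic W₁) = 0 → aeval e₂ (twoDivisionUCubic W₂) = 0 →
      AlignedAtTwo F e₁ e₂ → AlignedAtInfinity F (twoDivisionUCubic W₁) (twoDivisionUCubic W₂) e₁ e₂ →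
      ∀ [NeZero (W₁.conductorNorm ℤ)] [NeZero (W₂.conductorNorm ℤ)]
        (D₁ : ModularParametrizationData W₁ (W₁.conductorNorm ℤ)) (D₂ : ModularParametrizationData W₂ (W₂.conductorNorm ℤ)),
        Odd D₁.c → Odd D₂.c →
      ∀ (L : ℕ) [NeZero L], L = W₁.conductorNorm ℤ * ∏ q ∈ Q₂, q →
      ∀ (F₁ F₂ : CuspForm (Gamma0 L) 2),
        (∀ n : ℕ, cuspCoeff F₁ n =
          ∑ T ∈ Q₂.powerset, ((∏ q ∈ T, q : ℕ) : ℂ) * (if (∏ q ∈ T, q) ∣ n then cuspCoeff D₁.f (n / ∏ q ∈ T, q) else 0)) →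
        (∀ n : ℕ, cuspCoeff F₂ n =
          ∑ T ∈ Q₁.powerset, ((∏ q ∈ T, q : ℕ) : ℂ) * (if (∏ q ∈ T, q) ∣ n then cuspCoeff D₂.f (n / ∏ q ∈ T, q) else 0)) →
      ∀ y ∈ periodHomology L,
        D₁.uniformize ((D₁.c : ℂ) * y F₁ / 2) = 0 ↔ D₂.uniformize ((D₂.c : ℂ) * y F₂ / 2) = 0) :
    ∀ (W₁ : WeierstrassCurve ℚ) [W₁.IsElliptic] [W₁.IsGloballyMinimal]
      (W₂ : WeierstrassCurve ℚ) [W₂.IsElliptic] [W₂.IsGloballyMinimal],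
      IsOrdinaryAt W₁ 2 → IsOrdinaryAt W₂ 2 →
      (∀ x : ℚ, ¬ HasRationalTwoTorsionX W₁ x) → (∀ x : ℚ, ¬ HasRationalTwoTorsionX W₂ x) →
      ¬ IsSquare W₁.Δ → ¬ IsSquare W₂.Δ →
      (¬ ∃ (d : ℚ) (c : WeierstrassCurve.VariableChange ℚ), c • W₁.quadraticTwist d = W₂) →
      OnKilfordStratumAtTwo W₁ →
      Squarefree (W₁.conductorNorm ℤ) → Squarefree (W₂.conductorNorm ℤ) →
      ∀ (F : Type) [Field F] [NumberField F], Module.finrank ℚ F = 3 →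
      ∀ e₁ e₂ : F, aeval e₁ (twoDivisionUCubic W₁) = 0 → aeval e₂ (twoDivisionUCubic W₂) = 0 →
      AlignedAtTwo F e₁ e₂ → AlignedAtInfinity F (twoDivisionUCubic W₁) (twoDivisionUCubic W₂) e₁ e₂ →
      ∀ [NeZero (W₁.conductorNorm ℤ)] [NeZero (W₂.conductorNorm ℤ)]
        (D₁ : ModularParametrizationData W₁ (W₁.conductorNorm ℤ)) (D₂ : ModularParametrizationData W₂ (W₂.conductorNorm ℤ)),
        Odd D₁.c → Odd D₂.c →
      ∀ (N' : ℕ) [NeZero N'], N' = W₁.conductorNorm ℤ * W₂.conductorNorm ℤ *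
          ∏ ℓ ∈ (W₁.conductorNorm ℤ * W₂.conductorNorm ℤ).primeFactors.erase 2, ℓ ^ 2 →
      ∀ (g₁ g₂ : CuspForm (Gamma0 N') 2),
        (∀ n : ℕ, cuspCoeff g₁ n =
          if ∃ ℓ ∈ (W₁.conductorNorm ℤ * W₂.conductorNorm ℤ).primeFactors.erase 2, ℓ ∣ n then 0 else cuspCoeff D₁.f n) →
        (∀ n : ℕ, cuspCoeff g₂ n =
          if ∃ ℓ ∈ (W₁.conductorNorm ℤ * W₂.conductorNorm ℤ).primeFactors.erase 2, ℓ ∣ n then 0 else cuspCoeff D₂.f n) →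
      ∀ x ∈ periodHomology N',
        D₁.uniformize ((D₁.c : ℂ) *
            ((((∏ ℓ ∈ (W₁.conductorNorm ℤ * W₂.conductorNorm ℤ).primeFactors.erase 2, ℓ ^ 2 : ℕ) : ℂ) * x g₁) / 2)) = 0 ↔
          D₂.uniformize ((D₂.c : ℂ) *
            ((((∏ ℓ ∈ (W₁.conductorNorm ℤ * W₂.conductorNorm ℤ).primeFactors.erase 2, ℓ ^ 2 : ℕ) : ℂ) * x g₂) / 2)) = 0 := by
  intro W₁ _ _ W₂ _ _ hord₁ hord₂ ht₁ ht₂ hsq₁ hsq₂ htw hK hsf₁ hsf₂ F _ _ hF e₁ e₂ he₁ he₂ h2 hal _ _ D₁ D₂ hc₁ hc₂ N' _ hN' g₁ g₂ hg₁ hg₂ x hx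
  obtain ⟨N₀, Q₁, Q₂, hQ₁, hQ₂, hdisj, hQ₁N₀, hQ₂N₀, hN₁, hN₂⟩ := exists_semistableShape hsf₁ hsf₂
  exact sameDepletedKernel_semistableShape_of_twoOldLinesPlane' hPlane W₁ W₂ hord₁ hord₂ ht₁ ht₂ hsq₁ hsq₂ htw hK N₀ Q₁ Q₂ hQ₁ hQ₂ hdisj hQ₁N₀ hQ₂N₀
    hN₁ hN₂ F hF e₁ e₂ he₁ he₂ h2 hal D₁ D₂ hc₁ hc₂ N' hN' g₁ g₂ hg₁ hg₂ x hx

end Summit.BirchSwinnertonDyer.BirchSwinnertonDyer.Theorems.AlignedTransportAtTwoKilfordCopyCrossLevelSemistablePairs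

end
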